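import Summits.CriticalPhenomena.Ising3DConformalLimit.Theses.InverseSquareTelemetry
import Summits.CriticalPhenomena.Ising3DConformalLimit.Theses.PrecisionLaplacian
import Summits.CriticalPhenomena.Ising3DConformalLimit.Theorems.PrecisionLaplacianMoebiusLimitOfTwoPointLawDyadicReduction
import Summits.CriticalPhenomena.Ising3DConformalLimit.Theorems.GaussianLimitNotScreened.Negative.Reformulation
import Literature.Probability.LatticeModels.CriticalTwoPointLawDimension
import HarnessLib

/-!
# Skeleton v3 (lead c3) — crux `InverseSquareTelemetry.TwoPointSpineComplement` (item stmt-CriticalPhenomena-4497),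
# line `registered` (= the BC3 birth line `Lines/birth.lean`, reshaped by leads c1 and c3)

The crux (C) of route `InverseSquareTelemetry` is "the conjunct `Ising3DConformalLimit` GIVEN the isotropic pure
power law of the critical two-point function, with the SAME exponent `Δ`": for every witness `(Δ, c)` of
`⟨σ₀σ_x⟩_{β_c(3)}·|x|₂^{2Δ} → c > 0` there are `ρ > 0` on `(0,1]` and `S` with `0 < Δ`,
`HasPointwiseScalingLimit (criticalCorr 3) ρ S`, `IsNondegenerateTwoPoint S`, `IsMoebiusCovariant Δ S`, `HasNontrivialU4 S`.

After D₂ ∧ I₂ the crux holds a Möbius-covariant non-degenerate pointwise limit `(ρ, S)` with the dimension `Δ` OF THE LAW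
(`scalingDimension_eq_of_twoPointLaw`), and `Δ ∈ [1/2, 3/4]` by the tree theorem `dimension_window_and_eta` (infrared bound +
Duminil-Copin–Panis 2025 Thm 1.5). Clause (iii) `U₄ ≢ 0` therefore splits by regime:

* `stub_dyadicLimit` (D₂) — dyadic canonical existence of the even arities `n ≥ 4` under the law (shared verbatim with the
  registered lines of crux stmt-CriticalPhenomena-4801; `crux 4801 ↔ D₂ ∧ I₂`, p128000; payable by item 4738 under the law);
* `stub_dyadicInversion` (I₂) — unit-inversion covariance of every such dyadic limit (idem; payable by item 1982);
* `stub_noCoulombLaw` (α″, NEW in v3, replacing v2's `stub_coulombCorner` α′) — the Coulomb corner `Δ = 1/2` is EMPTY: for no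
  `c > 0` does `⟨σ₀σ_x⟩⁺_{β_c(3)}·|x|₂^{2·(1/2)} → c`. Why the reshape: cruxes stmt-8367 (`rotationUpgradeFromTwoPoint_proof`),
  stmt-1980 (`limitRotationInvariant_proof`) and stmt-1979 (`HRP2Rigidity_of`) are now PROVED, and 8367's edge theorem
  (`edge_limitConnectedFour_eq_zero`: at `Δ = 1/2` nine-mirror OS positivity + the harmonic OS null vector + Bôcher–Liouville
  force `U₄ ≡ 0`) makes the conclusion `HasNontrivialU4 S` of α′ unsatisfiable — so at the corner the composition can only
  close by emptiness of the corner, which is exactly α″. α″ is NECESSARY for (C) (`noCoulombLaw_of_twoPointSpineComplement`,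
  landed in `Theorems/InverseSquareTelemetryTwoPointSpineComplementHalfEdge.lean`), is implied by the v2 stubs D₂ ∧ I₂ ∧ α′
  (`noCoulombLaw_of_dyadic_of_coulombCorner`), and is a bare two-point statement (the weakest avatar of `η(3) ≠ 0`) payable by
  item stmt-1342 `NonSaturation` / stmt-2600 `EtaPositive` / (4738 ∧ 0636) / (4738 ∧ 13885) (edges landed in
  `Theorems/InverseSquareTelemetryTwoPointSpineComplementHalfEdgeEdges.lean`, p150645; moreover 4738 ∧ 0636 ⟹ 2600 and the summit
  conjunct ⟹ 2600, `…Screening.lean`, p151469);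
* `stub_noGaussianWindowLimit` (β) — the open window `1/2 < Δ < 3/4`: VERBATIM the registered leaf β of crux
  stmt-CriticalPhenomena-13886 `GaussianLimitNotScreened` (payers on the ledger: 0636, 2601, 15702 ∧ 15703, karamata capacity);
* `stub_noMarginalGaussianLimit` (γ) — the corner `Δ = 3/4`: VERBATIM the registered leaf γ of crux 13886 (landed payer edges
  from items 5507 `WindowBelowHalf`, 2601 `GaussianLimitIsFree`, 15703 `SubPtolemyFloor`; p102368, p142307).

Composition `TwoPointSpineComplement_of : D₂ → I₂ → α″ → β → γ → TwoPointSpineComplement` (no `sorry`): the landed dyadic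
reduction `moebiusLimitOfTwoPointLaw_of_dyadic` (p128000) gives for the witness `(Δ, c)` some `(ρ, Δ', S)`; rigidity pins
`Δ' = Δ`; the window theorem puts `Δ ∈ [1/2, 3/4]`; the corner `Δ = 1/2` contradicts α″; β and γ supply `U₄ ≢ 0` elsewhere.

Exactness (landed: `…Anatomy.lean` p146538 for v2, `…HalfEdgeEdges.lean` p150645 for v3): the crux is EQUIVALENT to
`D₂ ∧ I₂ ∧ α″ ∧ β′ ∧ γ′` with β′, γ′ the law-restricted forms of β, γ (`twoPointSpineComplement_iff_dyadic_noCoulomb_window`); no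
stub over-claims beyond dropping the law hypothesis in β, γ (kept verbatim-shared instead). Under (C) every law witness has
`1/2 < Δ ≤ 3/4` (`HalfEdge.window_of_twoPointSpineComplement`, p149757). By item NAME the crux is EXACTLY
`(0634 → 4738 ∧ 1982 ∧ 0636)` (`Split.twoPointSpineComplement_iff_subs`, glue `Split.TwoPointSpineComplement_of_subs`, p150831).

Disproof used: none exists for this crux (`ledger crux ls`: no `Disproof.lean`, 2026-08-17T07:50Z); the 4801 disproof's
`crux_iff_even_sharper` / `exponent_window` are honoured through p128000 and `dimension_window_and_eta`.
-/

noncomputable section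

namespace Summit.CriticalPhenomena.Ising3DConformalLimit.Cruxes.TwoPointSpineComplement.Birth

open Literature.Probability.LatticeModels Filter Topology EuclideanGeometry
open Summit.CriticalPhenomena.Ising3DConformalLimit.Theses.PrecisionLaplacian
  (MoebiusLimitOfTwoPointLaw IsingEuclidUpgradeR4NonGaussian)
open Summit.CriticalPhenomena.Ising3DConformalLimit.PrecisionLaplacianMoebiusLimitOfTwoPointLaw
  (moebiusLimitOfTwoPointLaw_of_dyadic)
open Summit.CriticalPhenomena.Ising3DConformalLimit.GaussianLimitNotScreenedNegative (dimension_window_and_eta)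

/-! ## Stubs -/

/-- **Stub D₂ (dyadic canonical existence, even arities `n ≥ 4`).** For every witness `(Δ, c)` of the
two-point law and every even `n ≥ 4`, the canonically renormalised `n`-point correlators
`δ_k^{-nΔ}⟨σ_{[x₁/δ_k]}⋯σ_{[xₙ/δ_k]}⟩⁺_{β_c}`, `δ_k = 2^{-k}`, converge locally uniformly on non-coincident
configurations to SOME `Tₙ`. OPEN (one-hierarchy existence of the critical `ℤ³` scaling limit along one mesh
sequence; Duminil-Copin ICM 2022 §8.4). Shared verbatim with the registered lines of crux stmt-4801. -/
theorem stub_dyadicLimit :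
    ∀ Δ c : ℝ, 0 < c →
      Tendsto (fun x : Site 3 =>
        criticalTwoPoint 3 x * Real.sqrt (∑ i, ((x i : ℝ)) ^ 2) ^ (2 * Δ)) cofinite (nhds c) →
      ∀ n, 4 ≤ n → Even n → ∃ Tn : (Fin n → EuclideanSpace ℝ (Fin 3)) → ℝ,
        TendstoLocallyUniformlyOn
          (fun k : ℕ => rescaledCorrelator (criticalCorr 3) (fun δ => δ ^ (-Δ)) n (((2:ℝ) ^ k)⁻¹))
          Tn atTop (NonCoincident 3 n) := by
  sorry

/-- **Stub I₂ (unit-inversion covariance of the dyadic canonical limits, even arities `n ≥ 4`).** For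
every witness `(Δ, c)` of the two-point law, every even `n ≥ 4` and EVERY dyadic canonical limit `Tₙ` as in
D₂, `Tₙ (ι x) = (∏ᵢ ‖xᵢ‖^{2Δ}) · Tₙ x` at non-coincident `x` off the origin, `ι x = x/‖x‖²`. OPEN
(inversion covariance of the critical `ℤ³` correlators; Euclid + scale ⇏ Möbius,
`Literature.Barriers.CriticalPhenomena.ScaleCovarianceNotMoebius` — the stub keeps the Ising hypothesis:
`Tₙ` is a limit OF `criticalCorr 3`). The factor `I₂` of the landed `MoebiusLimitOfTwoPointLaw ↔ D₂ ∧ I₂`. -/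
theorem stub_dyadicInversion :
    ∀ Δ c : ℝ, 0 < c →
      Tendsto (fun x : Site 3 =>
        criticalTwoPoint 3 x * Real.sqrt (∑ i, ((x i : ℝ)) ^ 2) ^ (2 * Δ)) cofinite (nhds c) →
      ∀ n, 4 ≤ n → Even n → ∀ Tn : (Fin n → EuclideanSpace ℝ (Fin 3)) → ℝ,
        TendstoLocallyUniformlyOn
          (fun k : ℕ => rescaledCorrelator (criticalCorr 3) (fun δ => δ ^ (-Δ)) n (((2:ℝ) ^ k)⁻¹))
          Tn atTop (NonCoincident 3 n) →
        ∀ x ∈ NonCoincident 3 n, (∀ i, x i ≠ 0) →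
          Tn (fun i => inversion 0 1 (x i)) = (∏ i, ‖x i‖ ^ (2 * Δ)) * Tn x := by
  sorry

/-- **Stub α″ (the Coulomb corner `Δ = 1/2` is EMPTY; `NoCoulombLaw`).** The critical two-point function of the
nearest-neighbour Ising model on `ℤ³` has no exact isotropic Coulomb asymptotics: for NO `c > 0` does
`⟨σ₀σ_x⟩⁺_{β_c(3)}·|x|₂^{2·(1/2)} → c` along the cofinite filter (`|x|₂ = √(∑ xᵢ²)`). This is the weakest avatar of
`η(3) ≠ 0` that the composition needs: at `Δ = 1/2` every non-degenerate Möbius-covariant pointwise limit of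
`criticalCorr 3` has `U₄ ≡ 0` (edge theorem of the proved crux stmt-8367 + proved 1980/1979, packaged as
`HalfEdge.not_hasNontrivialU4_of_moebius_half`), so the corner can only be closed by emptiness. NECESSARY for the crux
(`HalfEdge.noCoulombLaw_of_twoPointSpineComplement`). OPEN (expected true, `η(3) ≈ 0.036`); payers: item
stmt-CriticalPhenomena-1342 `PerfectScreening.NonSaturation` (`HalfEdge.noCoulombLaw_of_nonSaturation`), item
stmt-CriticalPhenomena-2600 `EtaPositive`, or items 4738 ∧ 0636 / 4738 ∧ 13885 (edges in `…HalfEdge.lean`). -/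
theorem stub_noCoulombLaw :
    ∀ c : ℝ, 0 < c → ¬ Tendsto (fun x : Site 3 =>
      criticalTwoPoint 3 x * Real.sqrt (∑ i, ((x i : ℝ)) ^ 2) ^ (2 * (1 / 2 : ℝ))) cofinite (nhds c) := by
  sorry

/-- **Stub β (the open window `1/2 < Δ < 3/4`; VERBATIM the registered leaf β `stub_noGaussianWindowLimit` of crux
stmt-CriticalPhenomena-13886).** A non-degenerate Möbius-covariant pointwise limit of `criticalCorr 3` with
`1/2 < Δ < 3/4` is not Gaussian: `U₄ ≢ 0`. OPEN (random-current merging at macroscopic separation in `d = 3`,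
Aizenman 1982 / Aizenman–Duminil-Copin 2021 eq. (3.11); payers 0636, 2601, 15702 ∧ 15703, karamata capacity). -/
theorem stub_noGaussianWindowLimit :
    ∀ (ρ : ℝ → ℝ) (Δ : ℝ) (S : CorrFamily 3), (∀ δ ∈ Set.Ioc (0:ℝ) 1, 0 < ρ δ) →
      HasPointwiseScalingLimit (criticalCorr 3) ρ S → IsNondegenerateTwoPoint S →
      IsMoebiusCovariant Δ S → 1 / 2 < Δ → Δ < 3 / 4 → HasNontrivialU4 S := by
  sorry

/-- **Stub γ (the marginal corner `Δ = 3/4`; VERBATIM the registered leaf γ `stub_noMarginalGaussianLimit` of crux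
stmt-CriticalPhenomena-13886).** A non-degenerate Möbius-covariant pointwise limit of `criticalCorr 3` with
`Δ = 3/4` (`η = 1/2`, the Duminil-Copin–Panis endpoint) is not Gaussian. OPEN; landed payer edges from items 5507
`WindowBelowHalf`, 2601 `GaussianLimitIsFree`, 15703 `SubPtolemyFloor` (`noMarginalGaussianLimit_of_*`). -/
theorem stub_noMarginalGaussianLimit :
    ∀ (ρ : ℝ → ℝ) (S : CorrFamily 3), (∀ δ ∈ Set.Ioc (0:ℝ) 1, 0 < ρ δ) →
      HasPointwiseScalingLimit (criticalCorr 3) ρ S → IsNondegenerateTwoPoint S →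
      IsMoebiusCovariant (3 / 4) S → HasNontrivialU4 S := by
  sorry

/-! ## Glue (no `sorry` below this line) -/

/-- D₂ and I₂ give the Möbius complement of the two-point law (item 4801), by the landed dyadic
reduction `moebiusLimitOfTwoPointLaw_of_dyadic` (p128000). -/
theorem moebiusLimitOfTwoPointLaw_of_stubs :
    (∀ Δ c : ℝ, 0 < c →
      Tendsto (fun x : Site 3 =>
        criticalTwoPoint 3 x * Real.sqrt (∑ i, ((x i : ℝ)) ^ 2) ^ (2 * Δ)) cofinite (nhds c) →
      ∀ n, 4 ≤ n → Even n → ∃ Tn : (Fin n → EuclideanSpace ℝ (Fin 3)) → ℝ,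
        TendstoLocallyUniformlyOn
          (fun k : ℕ => rescaledCorrelator (criticalCorr 3) (fun δ => δ ^ (-Δ)) n (((2:ℝ) ^ k)⁻¹))
          Tn atTop (NonCoincident 3 n)) →
    (∀ Δ c : ℝ, 0 < c →
      Tendsto (fun x : Site 3 =>
        criticalTwoPoint 3 x * Real.sqrt (∑ i, ((x i : ℝ)) ^ 2) ^ (2 * Δ)) cofinite (nhds c) →
      ∀ n, 4 ≤ n → Even n → ∀ Tn : (Fin n → EuclideanSpace ℝ (Fin 3)) → ℝ,
        TendstoLocallyUniformlyOn
          (fun k : ℕ => rescaledCorrelator (criticalCorr 3) (fun δ => δ ^ (-Δ)) n (((2:ℝ) ^ k)⁻¹))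
          Tn atTop (NonCoincident 3 n) →
        ∀ x ∈ NonCoincident 3 n, (∀ i, x i ≠ 0) →
          Tn (fun i => inversion 0 1 (x i)) = (∏ i, ‖x i‖ ^ (2 * Δ)) * Tn x) →
    MoebiusLimitOfTwoPointLaw :=
  moebiusLimitOfTwoPointLaw_of_dyadic

/-- **Composition: the crux from the stubs, BY NAME.** `D₂ → I₂ → α″ → β → γ → TwoPointSpineComplement`.
Given a witness `(Δ, c)`: D₂ + I₂ give (item 4801) some `(ρ, Δ', S)` with a non-degenerate Möbius-covariant
pointwise scaling limit of dimension `Δ'`; the two-point law pins `Δ' = Δ` (`scalingDimension_eq_of_twoPointLaw`);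
the window theorem gives `Δ ∈ [1/2, 3/4]` (hence `0 < Δ`); the corner `Δ = 1/2` is empty by α″ (the law hypothesis
is then the Coulomb law), in the window β applies, in the corner `Δ = 3/4` γ applies. -/
theorem TwoPointSpineComplement_of :
    (∀ Δ c : ℝ, 0 < c →
      Tendsto (fun x : Site 3 =>
        criticalTwoPoint 3 x * Real.sqrt (∑ i, ((x i : ℝ)) ^ 2) ^ (2 * Δ)) cofinite (nhds c) →
      ∀ n, 4 ≤ n → Even n → ∃ Tn : (Fin n → EuclideanSpace ℝ (Fin 3)) → ℝ,
        TendstoLocallyUniformlyOn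
          (fun k : ℕ => rescaledCorrelator (criticalCorr 3) (fun δ => δ ^ (-Δ)) n (((2:ℝ) ^ k)⁻¹))
          Tn atTop (NonCoincident 3 n)) →
    (∀ Δ c : ℝ, 0 < c →
      Tendsto (fun x : Site 3 =>
        criticalTwoPoint 3 x * Real.sqrt (∑ i, ((x i : ℝ)) ^ 2) ^ (2 * Δ)) cofinite (nhds c) →
      ∀ n, 4 ≤ n → Even n → ∀ Tn : (Fin n → EuclideanSpace ℝ (Fin 3)) → ℝ,
        TendstoLocallyUniformlyOn
          (fun k : ℕ => rescaledCorrelator (criticalCorr 3) (fun δ => δ ^ (-Δ)) n (((2:ℝ) ^ k)⁻¹))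
          Tn atTop (NonCoincident 3 n) →
        ∀ x ∈ NonCoincident 3 n, (∀ i, x i ≠ 0) →
          Tn (fun i => inversion 0 1 (x i)) = (∏ i, ‖x i‖ ^ (2 * Δ)) * Tn x) →
    (∀ c : ℝ, 0 < c → ¬ Tendsto (fun x : Site 3 =>
      criticalTwoPoint 3 x * Real.sqrt (∑ i, ((x i : ℝ)) ^ 2) ^ (2 * (1 / 2 : ℝ))) cofinite (nhds c)) →
    (∀ (ρ : ℝ → ℝ) (Δ : ℝ) (S : CorrFamily 3), (∀ δ ∈ Set.Ioc (0:ℝ) 1, 0 < ρ δ) →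
      HasPointwiseScalingLimit (criticalCorr 3) ρ S → IsNondegenerateTwoPoint S →
      IsMoebiusCovariant Δ S → 1 / 2 < Δ → Δ < 3 / 4 → HasNontrivialU4 S) →
    (∀ (ρ : ℝ → ℝ) (S : CorrFamily 3), (∀ δ ∈ Set.Ioc (0:ℝ) 1, 0 < ρ δ) →
      HasPointwiseScalingLimit (criticalCorr 3) ρ S → IsNondegenerateTwoPoint S →
      IsMoebiusCovariant (3 / 4) S → HasNontrivialU4 S) →
    _root_.Summit.CriticalPhenomena.Ising3DConformalLimit.Theses.InverseSquareTelemetry.TwoPointSpineComplement := by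
  intro hD hI hα hβ hγ Δ c hc hP
  -- item 4801 from D₂ + I₂ (landed dyadic reduction), applied to the given witness `(Δ, c)`
  obtain ⟨ρ, Δ', S, hρ, hΔ', hlim, hnd, hmoeb⟩ :=
    moebiusLimitOfTwoPointLaw_of_stubs hD hI ⟨Δ, c, hc, hP⟩
  -- rigidity of the dimension: the two-point law forces `Δ' = Δ`
  have hEq : Δ' = Δ := scalingDimension_eq_of_twoPointLaw hc hP hlim hmoeb.isScaleCovariant hnd
  subst hEq
  refine ⟨ρ, S, hρ, hΔ', hlim, hnd, hmoeb, ?_⟩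
  -- the window `Δ' ∈ [1/2, 3/4]` (infrared bound + Duminil-Copin–Panis 2025 Thm 1.5)
  obtain ⟨⟨h₁, h₂⟩, -⟩ := dimension_window_and_eta hρ hlim hnd hmoeb.isScaleCovariant
  rcases h₁.eq_or_lt with h | h
  · -- Coulomb corner `Δ' = 1/2`: empty by α″ (the law hypothesis `hP` is then the Coulomb law)
    subst h
    exact absurd hP (hα c hc)
  rcases h₂.lt_or_eq with h' | h'
  · -- open window
    exact hβ ρ Δ' S hρ hlim hnd hmoeb h h'
  · -- marginal corner `Δ' = 3/4`
    subst h'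
    exact hγ ρ S hρ hlim hnd hmoeb

/-- The stubs actually used by `TwoPointSpineComplement_of`, assembled: the crux holds modulo exactly
`stub_dyadicLimit`, `stub_dyadicInversion`, `stub_noCoulombLaw`, `stub_noGaussianWindowLimit`,
`stub_noMarginalGaussianLimit`. -/
theorem TwoPointSpineComplement_of_stubs :
    _root_.Summit.CriticalPhenomena.Ising3DConformalLimit.Theses.InverseSquareTelemetry.TwoPointSpineComplement :=
  TwoPointSpineComplement_of stub_dyadicLimit stub_dyadicInversion stub_noCoulombLaw
    stub_noGaussianWindowLimit stub_noMarginalGaussianLimit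

end Summit.CriticalPhenomena.Ising3DConformalLimit.Cruxes.TwoPointSpineComplement.Birth

end
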